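import Literature.NumberTheory.Transcendental.HyperlogarithmsTopExpansion
import Literature.NumberTheory.Transcendental.HyperlogarithmsAtOne
import Literature.NumberTheory.Transcendental.HyperlogarithmsMovingLetters
import HarnessLib

/-!
# Hyperlogarithms on `(0,1)`, XI: the values at `1` — identification and dependence on the letters

Eleventh layer of the analytic road to `GenusZeroPeriodsMZV` (Brown 2009), joining layers IV
(`hlogAt1`, `genAssoc`), IX (`regTop`) and X (moving letters):

* `Hyperlog.regTop_eq_genAssoc`: the regularised value at `1` of layer IX (the constant term of
  the logarithmic Taylor expansion of `s ↦ L(1-s)_W`) IS the generalised associator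
  `Z^σ_W = Σ_v (reg_{z,o} W)_v L_v(1)` of layer IV — from the two-sided factorisation
  `L(b) = exp(-log(1-b) o) ⟨L(b), reg⟩ exp(log b z)` at `b = 1 - s`, the rate
  `⟨L(1-s), reg B⟩ - Z^σ_B = O((1+|log s|)^n s)` and the asymptotic uniqueness of layer VI
  (`hasRegValue_hlogSeries_one_sub`).
* `Hyperlog.hasDerivAt_hlogAt1_family` (**Theorem T1b**): for a one-parameter family of admissible
  alphabets (letters at `0` and at `1` fixed, the others moving differentiably, distinct letters
  with distinct values) and a doubly regular word `v`, `y ↦ L_v(1; σ_y)` is differentiable with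
  derivative the deletion sum at the top `Hyperlog.Dtop` (Goncharov's formula at the end-point,
  the deletions exposing a letter at `1` dropping out, `lam_sub_lamEnd1_eq_zero`). Proof: the
  derivatives `D_v(b)` of layer X converge to `D_v(1)` as `b → 1⁻` UNIFORMLY in the parameter
  (`abs_Dhlog_sub_Dtop_le`, from the rate `hlogAt1_sub_le` and the logarithmic growth
  `hlog_le_log_pow` of layer IV), and `hasDerivAt_of_tendstoUniformlyOn`.

No named fact is introduced.

## References

* F. C. S. Brown, *Multiple zeta values and periods of moduli spaces `𝔐̄_{0,n}`*, Ann. Sci. Éc.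
  Norm. Supér. (4) 42 (2009), 371–489, §5.1, §5.5 (Def. 5.10), §6.1. doi:10.24033/asens.2099.
  [BrownENS2009]
* A. B. Goncharov, *Multiple polylogarithms, cyclotomy and modular complexes*, Math. Res. Lett.
  5 (1998), 497–516, Thm 2.1.
-/

noncomputable section

open MeasureTheory intervalIntegral Set Filter
open scoped BigOperators Topology

namespace Literature.NumberTheory.Transcendental

namespace Hyperlog

variable {α : Type*}

/-! ### `regTop = genAssoc` -/

section RegTopGenAssoc

variable [Fintype α] [DecidableEq α] {σ : α → ℝ} {z o : α} (hz : σ z = 0) (hσz : ∀ c, c ≠ z → 1 ≤ σ c)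
  (ho : σ o = 1) (hσo : ∀ c, c ≠ o → σ c ≠ 1)
include hz hσz ho hσo

omit [DecidableEq α] hz hσz ho hσo in
/-- `0 ≤ topBound σ x` for `x > 0`. [folklore] -/
theorem topBound_nonneg {x : ℝ} (hx : 0 < x) : 0 ≤ topBound σ x :=
  le_trans (by positivity) (topBound_ge σ x).1

/-- `⟨L(1-s), reg B⟩ → Z^σ_B` as `s → 0⁺`. [folklore] -/
theorem tendsto_hlogReg2_one_sub (B : List α) :
    Tendsto (fun s => hlogReg2 σ z o B (1 - s)) (𝓝[>] 0) (𝓝 (genAssoc σ z o B)) := by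
  have h := tendsto_hlogReg2 hz hσz ho hσo B
  have hmap : Tendsto (fun s : ℝ => 1 - s) (𝓝[>] 0) (𝓝[<] 1) := by
    refine tendsto_nhdsWithin_of_tendsto_nhds_of_eventually_within _ ?_ ?_
    · have : Tendsto (fun s : ℝ => 1 - s) (𝓝 0) (𝓝 (1 - 0)) := (continuous_const.sub continuous_id).tendsto 0
      rw [sub_zero] at this
      exact this.mono_left nhdsWithin_le_nhds
    · filter_upwards [self_mem_nhdsWithin] with s hs
      exact sub_lt_self _ (show (0 : ℝ) < s from hs)
  exact h.comp hmap

/-- **Rate**: `(⟨L(1-s), reg B⟩ - Z^σ_B) logᵏ s → 0` as `s → 0⁺`. [folklore] -/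
theorem tendsto_hlogReg2_sub_mul_log_pow (B : List α) (k : ℕ) :
    Tendsto (fun s => (hlogReg2 σ z o B (1 - s) - genAssoc σ z o B) * Real.log s ^ k) (𝓝[>] 0) (𝓝 0) := by
  classical
  have hσ := adm_of_zero_letter σ hz hσz
  set n := B.length with hn
  set M : ℝ := topBound σ (1 / 2) with hM
  have hM0 : 0 ≤ M := topBound_nonneg (by norm_num)
  set Cst : ℝ := (n + 1) * (M ^ n * ((n + 1) * 4 ^ n)) with hCst
  set A : ℝ := ∑ v ∈ (Shuffle.reg z o B).support, |((Shuffle.reg z o B) v : ℝ)| * Cst with hA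
  have hlim := (tendsto_pow_log_mul_self 1 (n + k)).const_mul A
  rw [mul_zero] at hlim
  refine squeeze_zero_norm' ?_ hlim
  filter_upwards [Ioo_mem_nhdsGT (by norm_num : (0 : ℝ) < 1 / 2)] with s hs
  have hb : 1 - s ∈ Ioo (1 / 2 : ℝ) 1 := ⟨by linarith [hs.2], by linarith [hs.1]⟩
  rw [Real.norm_eq_abs, abs_mul, abs_pow]
  -- the difference as a finite sum over the support of `reg B`
  have hdiff : hlogReg2 σ z o B (1 - s) - genAssoc σ z o B =
      ∑ v ∈ (Shuffle.reg z o B).support, ((Shuffle.reg z o B) v : ℝ) * (hlog σ v (1 - s) - hlogAt1 σ v) := by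
    unfold hlogReg2 genAssoc Shuffle.pair
    simp only [Finsupp.sum, Rat.smul_def, ← Finset.sum_sub_distrib, mul_sub]
  rw [hdiff]
  have hterm : ∀ v ∈ (Shuffle.reg z o B).support,
      |((Shuffle.reg z o B) v : ℝ) * (hlog σ v (1 - s) - hlogAt1 σ v)| ≤
        |((Shuffle.reg z o B) v : ℝ)| * Cst * ((1 + |Real.log s|) ^ n * s) := by
    intro v hv
    have hreg := isReg_of_mem_support_reg hz hσz (z_ne_o hz ho) B hv
    have htop := isTopReg_of_mem_support_reg hσo B hv
    have hlen : v.length = n := by rw [hn]; exact Shuffle.length_eq_of_mem_support_reg z o B hv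
    obtain ⟨h0, h1⟩ := hlogAt1_sub_le hσ hreg htop hb
    rw [abs_mul, mul_assoc]
    refine mul_le_mul_of_nonneg_left ?_ (abs_nonneg _)
    rw [abs_sub_comm, abs_of_nonneg h0]
    refine h1.trans ?_
    rw [hlen, show (1 : ℝ) - (1 - s) = s by ring]
    have hT : topBound σ (1 - s) ^ n ≤ M ^ n :=
      pow_le_pow_left₀ (topBound_nonneg (by linarith [hs.2])) (topBound_le_half σ hb.1.le) n
    have hL0 : 0 ≤ (1 + |Real.log s|) ^ n := by positivity
    calc (n + 1 : ℝ) * (topBound σ (1 - s) ^ n * ((n + 1) * 4 ^ n * (1 + |Real.log s|) ^ n)) * s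
        ≤ (n + 1 : ℝ) * (M ^ n * ((n + 1) * 4 ^ n * (1 + |Real.log s|) ^ n)) * s := by
          refine mul_le_mul_of_nonneg_right (mul_le_mul_of_nonneg_left
            (mul_le_mul_of_nonneg_right hT (by positivity)) (by positivity)) hs.1.le
      _ = Cst * ((1 + |Real.log s|) ^ n * s) := by rw [hCst]; ring
  have hsum := Finset.sum_le_sum hterm
  have hCst0 : 0 ≤ Cst := by rw [hCst]; positivity
  calc |∑ v ∈ (Shuffle.reg z o B).support, ((Shuffle.reg z o B) v : ℝ) * (hlog σ v (1 - s) - hlogAt1 σ v)| *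
        |Real.log s| ^ k
      ≤ (∑ v ∈ (Shuffle.reg z o B).support, |((Shuffle.reg z o B) v : ℝ)| * Cst * ((1 + |Real.log s|) ^ n * s)) *
        |Real.log s| ^ k :=
        mul_le_mul_of_nonneg_right ((Finset.abs_sum_le_sum_abs _ _).trans hsum) (pow_nonneg (abs_nonneg _) _)
    _ = A * (((1 + |Real.log s|) ^ n * |Real.log s| ^ k) * s) := by
        rw [hA, Finset.sum_mul, Finset.sum_mul]; refine Finset.sum_congr rfl fun v _ => ?_; ring
    _ ≤ A * ((|Real.log s| + 1) ^ (n + k) * s) := by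
        refine mul_le_mul_of_nonneg_left (mul_le_mul_of_nonneg_right ?_ hs.1.le) ?_
        · rw [pow_add, add_comm (|Real.log s|) 1]
          refine mul_le_mul_of_nonneg_left ?_ (by positivity)
          exact pow_le_pow_left₀ (abs_nonneg _) (by linarith [abs_nonneg (Real.log s)]) k
        · rw [hA]; exact Finset.sum_nonneg fun v _ => mul_nonneg (abs_nonneg _) hCst0

/-- `⟨L(1-s), reg B⟩` is eventually bounded near `s = 0⁺`. [folklore] -/
theorem eventually_abs_hlogReg2_le (B : List α) :
    ∀ᶠ s in 𝓝[>] (0 : ℝ), |hlogReg2 σ z o B (1 - s)| ≤ |genAssoc σ z o B| + 1 := by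
  have h := (tendsto_hlogReg2_one_sub hz hσz ho hσo B).sub_const (genAssoc σ z o B)
  rw [sub_self] at h
  have h1 : ∀ᶠ s in 𝓝[>] (0 : ℝ), |hlogReg2 σ z o B (1 - s) - genAssoc σ z o B| < 1 := by
    have := h.abs
    rw [abs_zero] at this
    exact this (Iio_mem_nhds one_pos)
  filter_upwards [h1] with s hs
  calc |hlogReg2 σ z o B (1 - s)| = |genAssoc σ z o B + (hlogReg2 σ z o B (1 - s) - genAssoc σ z o B)| := by ring_nf
    _ ≤ |genAssoc σ z o B| + |hlogReg2 σ z o B (1 - s) - genAssoc σ z o B| := abs_add_le _ _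
    _ ≤ |genAssoc σ z o B| + 1 := by linarith

/-- The regularised value of one term of the two-sided factorisation at `b = 1 - s`:
`exp(-log s · o)_A · ⟨L(1-s), reg B⟩ · exp(log(1-s) · z)_V` has regularised value
`Z^σ_B` if `A = V = ∅` and `0` otherwise. [folklore] -/
theorem hasRegValue_factor_term (A B V : List α) :
    HasRegValue (fun s => Shuffle.expLetter o (-Real.log s) A * hlogReg2 σ z o B (1 - s) *
      Shuffle.expLetter z (Real.log (1 - s)) V) (if A = [] ∧ V = [] then genAssoc σ z o B else 0) := by
  classical
  by_cases hV : V = []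
  · subst hV
    simp only [and_true, Shuffle.expLetter_nil, mul_one]
    by_cases hA : A = List.replicate A.length o
    · set k := A.length with hk
      have hexp : ∀ s, Shuffle.expLetter o (-Real.log s) A =
          algebraMap ℚ ℝ (1 / (k.factorial : ℚ)) * (-1) ^ k * Real.log s ^ k := by
        intro s
        rw [hA, Shuffle.expLetter_replicate, neg_pow (Real.log s) k]; ring
      simp_rw [hexp]
      set q : ℝ := algebraMap ℚ ℝ (1 / (k.factorial : ℚ)) * (-1) ^ k with hq
      -- `q log^k s · R(1-s) = q Z_B log^k s + q (R(1-s) - Z_B) log^k s`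
      have h1 : HasRegValue (fun s : ℝ => q * genAssoc σ z o B * (s ^ (0 : ℤ) * Real.log s ^ k))
          (if A = [] then genAssoc σ z o B else 0) := by
        by_cases hk0 : k = 0
        · have hA0 : A = [] := List.length_eq_zero_iff.mp (hk ▸ hk0)
          rw [if_pos hA0]
          have hq1 : q = 1 := by rw [hq, hk0]; simp
          refine hasRegValue_of_tendsto ((tendsto_const_nhds (x := genAssoc σ z o B)).congr' ?_)
          filter_upwards [self_mem_nhdsWithin] with s _
          rw [hq1, hk0]; simp
        · have hA0 : A ≠ [] := fun h => hk0 (by rw [hk, h, List.length_nil])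
          rw [if_neg hA0]
          exact hasRegValue_singular (p := ((0 : ℤ), k)) (Or.inr ⟨rfl, Nat.pos_of_ne_zero hk0⟩) _
      have h2 : HasRegValue (fun s : ℝ => q * ((hlogReg2 σ z o B (1 - s) - genAssoc σ z o B) * Real.log s ^ k)) 0 := by
        refine hasRegValue_of_tendsto ?_
        have := (tendsto_hlogReg2_sub_mul_log_pow hz hσz ho hσo B k).const_mul q
        rwa [mul_zero] at this
      have h := h1.add h2
      rw [add_zero] at h
      refine h.congr ?_
      filter_upwards [self_mem_nhdsWithin] with s _
      rw [zpow_zero, one_mul]; ring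
    · have h0 : ∀ s, Shuffle.expLetter o (-Real.log s) A = 0 := fun s =>
        Shuffle.expLetter_apply_of_ne o _ hA
      have hA0 : A ≠ [] := by intro h; apply hA; rw [h]; rfl
      rw [if_neg hA0]
      refine (hasRegValue_of_tendsto tendsto_const_nhds).congr (Eventually.of_forall fun s => ?_)
      rw [h0]; ring
  · rw [if_neg (fun h => hV h.2)]
    by_cases hVz : V = List.replicate V.length z
    · set j := V.length with hj
      have hj1 : 1 ≤ j := Nat.pos_of_ne_zero fun h => hV (List.length_eq_zero_iff.mp (hj ▸ h))
      -- everything tends to `0`: `|log(1-s)|^j ≤ (2s)^j`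
      refine hasRegValue_of_tendsto ?_
      obtain ⟨CA, hCA⟩ : ∃ C : ℝ, ∀ s, |Shuffle.expLetter o (-Real.log s) A| ≤ C * |Real.log s| ^ A.length := by
        by_cases hA : A = List.replicate A.length o
        · refine ⟨|algebraMap ℚ ℝ (1 / (A.length.factorial : ℚ))|, fun s => ?_⟩
          conv_lhs => rw [hA]
          rw [Shuffle.expLetter_replicate, abs_mul, abs_pow, abs_neg]
        · exact ⟨0, fun s => by rw [Shuffle.expLetter_apply_of_ne o _ hA]; simp⟩
      have hCA0 : 0 ≤ CA := by
        have := hCA 1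
        rw [Real.log_one] at this
        by_cases hA0 : A.length = 0
        · rw [hA0, pow_zero, mul_one] at this; exact (abs_nonneg _).trans this
        · have h1 := hCA (Real.exp 1)
          rw [Real.log_exp, abs_one, one_pow, mul_one] at h1
          exact (abs_nonneg _).trans h1
      set R : ℝ := |genAssoc σ z o B| + 1 with hR
      have hlim := (tendsto_pow_log_mul_self 0 A.length).const_mul
        (CA * R * (|algebraMap ℚ ℝ (1 / (j.factorial : ℚ))| * 2 ^ j))
      rw [mul_zero] at hlim
      refine squeeze_zero_norm' ?_ hlim
      filter_upwards [eventually_abs_hlogReg2_le hz hσz ho hσo B,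
        Ioo_mem_nhdsGT (by norm_num : (0 : ℝ) < 1 / 2)] with s hRs hs
      rw [Real.norm_eq_abs, abs_mul, abs_mul]
      have hlog1 : |Real.log (1 - s)| ≤ 2 * s := abs_log_one_sub_le hs.1 hs.2.le
      have hE : |Shuffle.expLetter z (Real.log (1 - s)) V| ≤ |algebraMap ℚ ℝ (1 / (j.factorial : ℚ))| * 2 ^ j * s := by
        conv_lhs => rw [hVz]
        rw [Shuffle.expLetter_replicate, abs_mul, abs_pow, mul_assoc]
        refine mul_le_mul_of_nonneg_left ?_ (abs_nonneg _)
        calc |Real.log (1 - s)| ^ j ≤ (2 * s) ^ j := pow_le_pow_left₀ (abs_nonneg _) hlog1 j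
          _ = 2 ^ j * (s ^ (j - 1) * s) := by rw [mul_pow, ← pow_succ, Nat.sub_add_cancel hj1]
          _ ≤ 2 ^ j * (1 * s) := by
              refine mul_le_mul_of_nonneg_left (mul_le_mul_of_nonneg_right
                (pow_le_one₀ hs.1.le (by linarith [hs.2])) hs.1.le) (by positivity)
          _ = 2 ^ j * s := by rw [one_mul]
      calc |Shuffle.expLetter o (-Real.log s) A| * |hlogReg2 σ z o B (1 - s)| * |Shuffle.expLetter z (Real.log (1 - s)) V|
          ≤ (CA * |Real.log s| ^ A.length) * R * (|algebraMap ℚ ℝ (1 / (j.factorial : ℚ))| * 2 ^ j * s) :=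
            mul_le_mul (mul_le_mul (hCA s) hRs (abs_nonneg _) (by positivity)) hE (abs_nonneg _) (by positivity)
        _ = CA * R * (|algebraMap ℚ ℝ (1 / (j.factorial : ℚ))| * 2 ^ j) * ((|Real.log s| + 0) ^ A.length * s) := by ring
    · have h0 : ∀ s, Shuffle.expLetter z (Real.log (1 - s)) V = 0 := fun s =>
        Shuffle.expLetter_apply_of_ne z _ hVz
      refine (hasRegValue_of_tendsto tendsto_const_nhds).congr (Eventually.of_forall fun s => ?_)
      rw [h0]; ring

/-- **`L(1-s)_W` has the regularised value `Z^σ_W` at `s = 0⁺`.** [cite: BrownENS2009, §5.5 Def. 5.10] -/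
theorem hasRegValue_hlogSeries_one_sub (W : List α) :
    HasRegValue (fun s => hlogSeries σ z (1 - s) W) (genAssoc σ z o W) := by
  classical
  -- expand the two-sided factorisation at `b = 1 - s`
  have hsum := HasRegValue.sum (NCSeries.splits W) (φ := fun p s => ∑ q ∈ NCSeries.splits p.1,
      Shuffle.expLetter o (-Real.log s) q.1 * hlogReg2 σ z o q.2 (1 - s) * Shuffle.expLetter z (Real.log (1 - s)) p.2)
    (c := fun p => ∑ q ∈ NCSeries.splits p.1, if q.1 = [] ∧ p.2 = [] then genAssoc σ z o q.2 else 0)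
    fun p _ => HasRegValue.sum (NCSeries.splits p.1) fun q _ => hasRegValue_factor_term hz hσz ho hσo q.1 q.2 p.2
  have hval : (∑ p ∈ NCSeries.splits W, ∑ q ∈ NCSeries.splits p.1,
      if q.1 = [] ∧ p.2 = [] then genAssoc σ z o q.2 else 0) = genAssoc σ z o W := by
    rw [Finset.sum_eq_single_of_mem (W, ([] : List α)) (NCSeries.self_nil_mem_splits W)]
    · rw [Finset.sum_eq_single_of_mem (([] : List α), W) (NCSeries.nil_self_mem_splits W)]
      · simp
      · intro q hq hne
        rw [if_neg]
        rintro ⟨h1, -⟩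
        apply hne
        rw [NCSeries.mem_splits] at hq
        ext1
        · exact h1
        · simpa [h1] using hq
    · intro p hp hne
      refine Finset.sum_eq_zero fun q _ => if_neg ?_
      rintro ⟨-, h2⟩
      apply hne
      rw [NCSeries.mem_splits] at hp
      ext1
      · simpa [h2] using hp
      · exact h2
  rw [hval] at hsum
  refine hsum.congr ?_
  filter_upwards [Ioo_mem_nhdsGT (zero_lt_one' ℝ)] with s hs
  have hb : 1 - s ∈ Ioo (0 : ℝ) 1 := ⟨by linarith [hs.2], by linarith [hs.1]⟩
  have hfac := hlogSeries_factorisation hz hσz ho hb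
  have := congrFun hfac W
  rw [this, NCSeries.mul_apply]
  refine Finset.sum_congr rfl fun p _ => ?_
  rw [NCSeries.mul_apply, Finset.sum_mul]
  refine Finset.sum_congr rfl fun q _ => ?_
  rw [show (1 : ℝ) - (1 - s) = s by ring]

/-- **The regularised value at `1` of layer IX is the generalised associator of layer IV**:
`regTop σ z W = Z^σ_W`. [cite: BrownENS2009, §5.5 Def. 5.10] -/
theorem regTop_eq_genAssoc (W : List α) : regTop hz hσz W = genAssoc σ z o W := by
  have h1 := hasRegValue_zpow_mul_hlogSeries_one_sub hz hσz 0 W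
  simp only [le_refl, if_true, neg_zero, Int.toNat_zero] at h1
  have h2 : HasRegValue (fun s => s ^ (0 : ℤ) * hlogSeries σ z (1 - s) W) (genAssoc σ z o W) :=
    (hasRegValue_hlogSeries_one_sub hz hσz ho hσo W).congr (Eventually.of_forall fun s => by rw [zpow_zero, one_mul])
  exact h1.unique h2

end RegTopGenAssoc

/-! ### The deletion sum at the top end-point and the uniform rate -/

section TopDeriv

variable [Fintype α] [DecidableEq α] {σ σ' : α → ℝ} (hσ : ∀ c, σ c = 0 ∨ 1 ≤ σ c)
  (hZ : ∀ c, σ c = 0 → σ' c = 0) (hO : ∀ c, σ c = 1 → σ' c = 0)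
include hσ hZ hO

/-- The end-point pairing at `b = 1`: `σ'_c/(σ_c - 1)` (`0` for letters at `0`; letters at `1` do
not move). [folklore] -/
def lamEnd1 (σ σ' : α → ℝ) (c : α) : ℝ := if σ c = 0 then 0 else σ' c / (σ c - 1)

/-- The deletion sum with a nonempty prefix, evaluated at `b = 1` (values `L_W(1)`). [folklore] -/
def Dsum1 (σ σ' : α → ℝ) : List α → Option α → List α → ℝ
  | _, _, [] => 0
  | pre, o, a :: u => (lamIn σ σ' a u - lamOut σ σ' a 0 o) * hlogAt1 σ (pre ++ u)
      + Dsum1 σ σ' (pre ++ [a]) (some a) u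

/-- **The deletion sum at `1`**: `D_v(1⁻)`, the `y`-derivative of `L_v(1)`. [folklore] -/
def Dtop (σ σ' : α → ℝ) : List α → ℝ
  | [] => 0
  | c :: u => (lamIn σ σ' c u - lamEnd1 σ σ' c) * hlogAt1 σ u + Dsum1 σ σ' [c] (some c) u

omit [Fintype α] [DecidableEq α] hσ hZ hO in
/-- With an outer letter the outer pairing does not depend on `b`. [folklore] -/
theorem lamOut_some (a c : α) (b b' : ℝ) : lamOut σ σ' a b (some c) = lamOut σ σ' a b' (some c) := rfl

omit [Fintype α] [DecidableEq α] hσ in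
/-- The head coefficient vanishes at `b = 1` when the new head is at `1`. [folklore] -/
theorem lam_sub_lamEnd1_eq_zero {c a : α} (hc : σ c ≠ 1) (ha : σ a = 1) : lam σ σ' c a - lamEnd1 σ σ' c = 0 := by
  have ha' : σ' a = 0 := hO a ha
  by_cases hc0 : σ c = 0
  · have hc' : σ' c = 0 := hZ c hc0
    simp [lam, lamEnd1, lsign, ha, ha', hc0, hc']
  · have hne : σ c ≠ σ a := by rw [ha]; exact hc
    simp only [lam, lamEnd1, lsign, ha, ha', if_neg hc, if_neg hc0, mul_zero, add_zero]
    ring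

omit [Fintype α] [DecidableEq α] hσ hZ hO in
/-- Top-regularity only depends on the head. [folklore] -/
theorem isTopReg_append_iff {l m : List α} (hl : l ≠ []) : IsTopReg σ (l ++ m) ↔ IsTopReg σ l := by
  obtain ⟨x, l', rfl⟩ := List.exists_cons_of_ne_nil hl
  constructor
  · intro h _; simpa using h (by simp)
  · intro h _; simpa using h (by simp)

omit [Fintype α] [DecidableEq α] hO in
/-- Rate of the end-point pairing: `|Λ_end(c,b) - Λ_end(c,1)| ≤ S T² (1-b)` for `σ_c ≠ 1`,
`1/(σ_c - 1) ≤ T`. [folklore] -/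
theorem abs_lamEnd_sub_lamEnd1_le {c : α} (hc : σ c ≠ 1) {S T : ℝ} (hS : |σ' c| ≤ S)
    (hT : σ c ≠ 0 → 1 / (σ c - 1) ≤ T) {b : ℝ} (hb : b ∈ Ioo (0 : ℝ) 1) :
    |lamEnd σ σ' c b - lamEnd1 σ σ' c| ≤ S * T ^ 2 * (1 - b) := by
  have hS0 : 0 ≤ S := (abs_nonneg _).trans hS
  have h1b : 0 ≤ 1 - b := by linarith [hb.2]
  unfold lamEnd lamEnd1
  by_cases hc0 : σ c = 0
  · rw [hZ c hc0, if_pos hc0]; simp only [zero_mul, sub_zero, abs_zero]; positivity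
  · have hc1 : 1 < σ c := lt_of_le_of_ne ((hσ c).resolve_left hc0) (Ne.symm hc)
    have hT' := hT hc0
    have hcb : 0 < σ c - b := by linarith [hb.2]
    have hc1' : 0 < σ c - 1 := by linarith
    have hT0 : 0 ≤ T := le_trans (one_div_pos.2 hc1').le hT'
    rw [if_neg hc0, pden_of_ne_zero hσ hc0 hb.2]
    have heq : σ' c * (1 / (σ c - b)) - σ' c / (σ c - 1) =
        -(σ' c * ((1 - b) * ((1 / (σ c - b)) * (1 / (σ c - 1))))) := by
      field_simp; ring
    rw [heq, abs_neg, abs_mul]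
    have h3 : 1 / (σ c - b) ≤ T := (one_div_le_one_div_of_le hc1' (by linarith [hb.2])).trans hT'
    have hfrac : |(1 - b) * ((1 / (σ c - b)) * (1 / (σ c - 1)))| ≤ (1 - b) * (T * T) := by
      rw [abs_of_nonneg (by positivity)]
      exact mul_le_mul_of_nonneg_left (mul_le_mul h3 hT' (by positivity) hT0) h1b
    calc |σ' c| * |(1 - b) * ((1 / (σ c - b)) * (1 / (σ c - 1)))| ≤ S * ((1 - b) * (T * T)) :=
          mul_le_mul hS hfrac (abs_nonneg _) hS0
      _ = S * T ^ 2 * (1 - b) := by ring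

omit [DecidableEq α] hσ hZ hO in
/-- `4 ≤ topBound σ (1/2)`. [folklore] -/
theorem four_le_topBound : (4 : ℝ) ≤ topBound σ (1 / 2) := by
  have := (topBound_ge σ (1 / 2)).1; norm_num at this; linarith

omit [DecidableEq α] hZ hO in
/-- The rate at the top for a doubly regular word, with uniform constants:
`|L_W(b) - L_W(1)| ≤ (N+1)² (4T)^N (1+|log(1-b)|)^N (1-b)` for `|W| ≤ N`, `topBound σ (1/2) ≤ T`.
[folklore] -/
theorem abs_hlog_sub_hlogAt1_le {W : List α} (hW : IsReg σ W) (htop : IsTopReg σ W) {T : ℝ}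
    (hT : topBound σ (1 / 2) ≤ T) {N : ℕ} (hN : W.length ≤ N) {b : ℝ} (hb : b ∈ Ioo (1 / 2 : ℝ) 1) :
    |hlog σ W b - hlogAt1 σ W| ≤ (N + 1) ^ 2 * (4 * T) ^ N * (1 + |Real.log (1 - b)|) ^ N * (1 - b) := by
  classical
  obtain ⟨h0, h1⟩ := hlogAt1_sub_le hσ hW htop hb
  rw [abs_sub_comm, abs_of_nonneg h0]
  refine h1.trans ?_
  set n := W.length
  have hT0 : 0 ≤ topBound σ b := topBound_nonneg (by linarith [hb.1])
  have hTb : topBound σ b ≤ T := (topBound_le_half σ hb.1.le).trans hT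
  have h4T : 1 ≤ 4 * T := by have := four_le_topBound (σ := σ); linarith
  have hΛ : 1 ≤ 1 + |Real.log (1 - b)| := by linarith [abs_nonneg (Real.log (1 - b))]
  have h1b : 0 ≤ 1 - b := by linarith [hb.2]
  have hn1 : (n : ℝ) + 1 ≤ N + 1 := by exact_mod_cast Nat.succ_le_succ hN
  have hpow : topBound σ b ^ n * 4 ^ n ≤ (4 * T) ^ N := by
    rw [← mul_pow, mul_comm]
    exact (pow_le_pow_left₀ (by positivity) (by linarith) n).trans (pow_le_pow_right₀ h4T hN)
  calc (n + 1 : ℝ) * (topBound σ b ^ n * ((n + 1) * 4 ^ n * (1 + |Real.log (1 - b)|) ^ n)) * (1 - b)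
      = ((n + 1) * (n + 1)) * (topBound σ b ^ n * 4 ^ n) * (1 + |Real.log (1 - b)|) ^ n * (1 - b) := by ring
    _ ≤ ((N + 1) * (N + 1)) * (4 * T) ^ N * (1 + |Real.log (1 - b)|) ^ N * (1 - b) := by
        refine mul_le_mul_of_nonneg_right ?_ h1b
        refine mul_le_mul (mul_le_mul (mul_le_mul hn1 hn1 (by positivity) (by positivity)) hpow
          (by positivity) (by positivity)) (pow_le_pow_right₀ hΛ hN) (by positivity) (by positivity)
    _ = (N + 1) ^ 2 * (4 * T) ^ N * (1 + |Real.log (1 - b)|) ^ N * (1 - b) := by ring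

omit [Fintype α] [DecidableEq α] hZ hO in
/-- `|Λ_in(a,u)| ≤ Mcoef S δ 0` for letters in the bounded set. [folklore] -/
theorem abs_lamIn_le {L : Finset α} {S δ : ℝ} (hB : PBound σ σ' L S δ) {a : α} (ha : a ∈ L)
    {u : List α} (hu : ∀ x ∈ u, x ∈ L) : |lamIn σ σ' a u| ≤ Mcoef S δ 0 := by
  have hS0 : 0 ≤ S := (abs_nonneg _).trans (hB.deriv_le a ha)
  have hδ := hB.δ_pos
  have h2 : 0 ≤ 2 * S / δ := by positivity
  have h1 : |lamIn σ σ' a u| ≤ 2 * S / δ + S := by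
    cases u with
    | nil =>
      simp only [lamIn]
      have := abs_lamBase_le hσ (σ' := σ') (hB.deriv_le a ha)
      linarith
    | cons a' _ =>
      simp only [lamIn]
      have := abs_lam_le (σ := σ) (hB.deriv_le a ha) (hB.deriv_le a' (hu a' (by simp))) hδ
        (hB.gap a ha a' (hu a' (by simp)))
      linarith
  unfold Mcoef
  have : S / (1 - 0) = S := by norm_num
  rw [this]
  have : 4 * S / δ = 2 * (2 * S / δ) := by ring
  linarith

omit [Fintype α] [DecidableEq α] hZ hO in
/-- `|Λ_in(a,u) - Λ(a,c₀)| ≤ Mcoef S δ 0`. [folklore] -/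
theorem abs_lamIn_sub_lam_le {L : Finset α} {S δ : ℝ} (hB : PBound σ σ' L S δ) {a : α} (ha : a ∈ L)
    {u : List α} (hu : ∀ x ∈ u, x ∈ L) {c₀ : α} (hc₀ : c₀ ∈ L) :
    |lamIn σ σ' a u - lam σ σ' a c₀| ≤ Mcoef S δ 0 := by
  have hS0 : 0 ≤ S := (abs_nonneg _).trans (hB.deriv_le a ha)
  have hδ := hB.δ_pos
  have h1 : |lamIn σ σ' a u| ≤ 2 * S / δ + S := by
    cases u with
    | nil =>
      simp only [lamIn]
      have := abs_lamBase_le hσ (σ' := σ') (hB.deriv_le a ha)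
      have : 0 ≤ 2 * S / δ := by positivity
      linarith
    | cons a' _ =>
      simp only [lamIn]
      have := abs_lam_le (σ := σ) (hB.deriv_le a ha) (hB.deriv_le a' (hu a' (by simp))) hδ
        (hB.gap a ha a' (hu a' (by simp)))
      linarith
  have h2 := abs_lam_le (σ := σ) (hB.deriv_le a ha) (hB.deriv_le c₀ hc₀) hδ (hB.gap a ha c₀ hc₀)
  have h3 : (2 * S / δ + S) + 2 * S / δ ≤ Mcoef S δ 0 := by
    unfold Mcoef
    have : S / (1 - 0) = S := by norm_num
    rw [this]
    have : 4 * S / δ = 2 * (2 * S / δ) := by ring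
    linarith
  calc |lamIn σ σ' a u - lam σ σ' a c₀| ≤ |lamIn σ σ' a u| + |lam σ σ' a c₀| := abs_sub _ _
    _ ≤ (2 * S / δ + S) + 2 * S / δ := add_le_add h1 h2
    _ ≤ Mcoef S δ 0 := h3

omit [DecidableEq α] hO in
/-- **Rate for the inner deletion sums**: with a nonempty prefix whose head is not at `1`,
`|Dsum P (some c₀) w b - Dsum1 P (some c₀) w| ≤ |w| M₀ R(b)`, `R(b) = (N+1)²(4T)^N Λ^N (1-b)`.
[folklore] -/
theorem abs_Dsum_sub_Dsum1_le {L : Finset α} {S δ : ℝ} (hB : PBound σ σ' L S δ) {T : ℝ}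
    (hT : topBound σ (1 / 2) ≤ T) : ∀ (w : List α), IsReg σ w → (∀ x ∈ w, x ∈ L) →
    ∀ (pre : List α) (c₀ : α), (∀ x ∈ pre, x ∈ L) → c₀ ∈ L → IsTopReg σ (pre ++ [c₀]) →
    ∀ {N : ℕ}, pre.length + 1 + w.length ≤ N → ∀ {b : ℝ}, b ∈ Ioo (1 / 2 : ℝ) 1 →
    |Dsum σ σ' b (pre ++ [c₀]) (some c₀) w - Dsum1 σ σ' (pre ++ [c₀]) (some c₀) w| ≤
      w.length * Mcoef S δ 0 * ((N + 1) ^ 2 * (4 * T) ^ N * (1 + |Real.log (1 - b)|) ^ N * (1 - b)) := by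
  intro w
  induction w with
  | nil => intros; simp [Dsum, Dsum1]
  | cons a u IH =>
    intro hreg hL pre c₀ hpre hc₀ htop N hN b hb
    have hb' : b ∈ Ioo (0 : ℝ) 1 := ⟨by linarith [hb.1], hb.2⟩
    have haL : a ∈ L := hL a (by simp)
    have huL : ∀ x ∈ u, x ∈ L := fun x hx => hL x (by simp [hx])
    simp only [Dsum, Dsum1]
    have htop' : IsTopReg σ (pre ++ [c₀] ++ [a]) :=
      (isTopReg_append_iff (l := pre ++ [c₀]) (m := [a]) (by simp)).2 htop
    have IH' := IH (hreg.tail σ) huL (pre ++ [c₀]) a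
      (fun x hx => by simp at hx; rcases hx with hx | rfl; exacts [hpre x hx, hc₀]) haL htop'
      (N := N) (by simp at hN ⊢; omega) hb
    have hMco : |lamIn σ σ' a u - lamOut σ σ' a b (some c₀)| ≤ Mcoef S δ 0 := by
      simp only [lamOut]; exact abs_lamIn_sub_lam_le hσ hB haL huL hc₀
    have hM0 : 0 ≤ Mcoef S δ 0 := (abs_nonneg _).trans hMco
    have hT1 : 0 ≤ T := (topBound_nonneg (by norm_num)).trans hT
    have hrate0 : 0 ≤ (N + 1 : ℝ) ^ 2 * (4 * T) ^ N * (1 + |Real.log (1 - b)|) ^ N * (1 - b) := by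
      have := hb.2; positivity
    -- the first term
    have hfirst : |(lamIn σ σ' a u - lamOut σ σ' a b (some c₀)) * hlog σ (pre ++ [c₀] ++ u) b -
        (lamIn σ σ' a u - lamOut σ σ' a 0 (some c₀)) * hlogAt1 σ (pre ++ [c₀] ++ u)| ≤
        Mcoef S δ 0 * ((N + 1) ^ 2 * (4 * T) ^ N * (1 + |Real.log (1 - b)|) ^ N * (1 - b)) := by
      rw [lamOut_some (σ := σ) (σ' := σ') a c₀ 0 b, ← mul_sub]
      by_cases hdeg : u = [] ∧ σ c₀ = 0
      · obtain ⟨hu, hc⟩ := hdeg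
        subst hu
        simp only [lamOut]
        rw [lamIn_nil_sub_lam_eq_zero hZ a c₀ hc, zero_mul, abs_zero]
        positivity
      · have hregw : IsReg σ (pre ++ [c₀] ++ u) := by
          by_cases hu : u = []
          · subst hu; intro hne; simpa using (show σ c₀ ≠ 0 from fun h => hdeg ⟨rfl, h⟩)
          · exact (isReg_append_iff hu).2 ((isReg_cons_of_ne_nil σ hu).1 hreg)
        have htopw : IsTopReg σ (pre ++ [c₀] ++ u) :=
          (isTopReg_append_iff (l := pre ++ [c₀]) (m := u) (by simp)).2 htop
        rw [abs_mul]
        exact mul_le_mul hMco (abs_hlog_sub_hlogAt1_le hσ hregw htopw hT (by simp at hN ⊢; omega) hb)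
          (abs_nonneg _) hM0
    calc |(lamIn σ σ' a u - lamOut σ σ' a b (some c₀)) * hlog σ (pre ++ [c₀] ++ u) b +
          Dsum σ σ' b (pre ++ [c₀] ++ [a]) (some a) u -
          ((lamIn σ σ' a u - lamOut σ σ' a 0 (some c₀)) * hlogAt1 σ (pre ++ [c₀] ++ u) +
            Dsum1 σ σ' (pre ++ [c₀] ++ [a]) (some a) u)|
        = |((lamIn σ σ' a u - lamOut σ σ' a b (some c₀)) * hlog σ (pre ++ [c₀] ++ u) b -
            (lamIn σ σ' a u - lamOut σ σ' a 0 (some c₀)) * hlogAt1 σ (pre ++ [c₀] ++ u)) +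
          (Dsum σ σ' b (pre ++ [c₀] ++ [a]) (some a) u - Dsum1 σ σ' (pre ++ [c₀] ++ [a]) (some a) u)| := by ring_nf
      _ ≤ _ := abs_add_le _ _
      _ ≤ Mcoef S δ 0 * ((N + 1) ^ 2 * (4 * T) ^ N * (1 + |Real.log (1 - b)|) ^ N * (1 - b)) +
          u.length * Mcoef S δ 0 * ((N + 1) ^ 2 * (4 * T) ^ N * (1 + |Real.log (1 - b)|) ^ N * (1 - b)) :=
          add_le_add hfirst IH'
      _ = (a :: u).length * Mcoef S δ 0 * ((N + 1) ^ 2 * (4 * T) ^ N * (1 + |Real.log (1 - b)|) ^ N * (1 - b)) := by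
          simp; ring

/-- **Uniform rate at the top for the deletion sum** of a doubly regular word `v`:
`|D_v(b) - D_v(1)| ≤ K R(b)`, `K = N M₀ + S T² + M₀ + S T`, `R(b) = (N+1)²(4T)^N Λ^N (1-b)`.
[folklore] -/
theorem abs_Dhlog_sub_Dtop_le {L : Finset α} {S δ : ℝ} (hB : PBound σ σ' L S δ) (hS0 : 0 ≤ S) {T : ℝ}
    (hT : topBound σ (1 / 2) ≤ T) {v : List α} (hv : IsReg σ v) (htop : IsTopReg σ v)
    (hL : ∀ x ∈ v, x ∈ L) {N : ℕ} (hN : v.length ≤ N) {b : ℝ} (hb : b ∈ Ioo (1 / 2 : ℝ) 1) :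
    |Dhlog σ σ' v b - Dtop σ σ' v| ≤
      (N * Mcoef S δ 0 + (S * T ^ 2 + Mcoef S δ 0 + S * T)) *
        ((N + 1) ^ 2 * (4 * T) ^ N * (1 + |Real.log (1 - b)|) ^ N * (1 - b)) := by
  have hb' : b ∈ Ioo (0 : ℝ) 1 := ⟨by linarith [hb.1], hb.2⟩
  have h4 : (4 : ℝ) ≤ T := (four_le_topBound (σ := σ)).trans hT
  have hT1 : 1 ≤ T := by linarith
  have hΛ1 : 1 ≤ 1 + |Real.log (1 - b)| := by linarith [abs_nonneg (Real.log (1 - b))]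
  have hδ := hB.δ_pos
  have hM0 : 0 ≤ Mcoef S δ 0 := by unfold Mcoef; norm_num; positivity
  set Λ := 1 + |Real.log (1 - b)| with hΛ
  set r : ℝ := 1 - b with hr
  have hr0 : 0 ≤ r := by rw [hr]; linarith [hb.2]
  set P : ℝ := (N + 1) ^ 2 * (4 * T) ^ N * Λ ^ N with hP
  have hN1 : (1 : ℝ) ≤ N + 1 := by linarith [show (0:ℝ) ≤ N from Nat.cast_nonneg N]
  have hP1 : 1 ≤ P := by
    rw [hP]
    refine one_le_mul_of_one_le_of_one_le (one_le_mul_of_one_le_of_one_le (by nlinarith) (one_le_pow₀ (by linarith)))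
      (one_le_pow₀ hΛ1)
  have hP0 : 0 ≤ P := zero_le_one.trans hP1
  have hPr0 : 0 ≤ P * r := mul_nonneg hP0 hr0
  have hRr : r ≤ P * r := le_mul_of_one_le_left hr0 hP1
  have hST : 0 ≤ S * T := by positivity
  have hST2 : 0 ≤ S * T ^ 2 := by positivity
  show |Dhlog σ σ' v b - Dtop σ σ' v| ≤ (N * Mcoef S δ 0 + (S * T ^ 2 + Mcoef S δ 0 + S * T)) * (P * r)
  cases v with
  | nil =>
    simp only [Dhlog, Dsum, Dtop, sub_self, abs_zero]
    positivity
  | cons c u =>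
    have hc : c ∈ L := hL c (by simp)
    have huL : ∀ x ∈ u, x ∈ L := fun x hx => hL x (by simp [hx])
    have hc1 : σ c ≠ 1 := by have := htop (List.cons_ne_nil c u); simpa using this
    have hregu : IsReg σ u := hv.tail σ
    have hul : u.length ≤ N := by simp at hN; omega
    have hDu : Dhlog σ σ' (c :: u) b = (lamIn σ σ' c u - lamEnd σ σ' c b) * hlog σ u b +
        Dsum σ σ' b ([] ++ [c]) (some c) u := by simp [Dhlog, Dsum, lamIn, lamOut]
    have hD1 : Dtop σ σ' (c :: u) = (lamIn σ σ' c u - lamEnd1 σ σ' c) * hlogAt1 σ u +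
        Dsum1 σ σ' ([] ++ [c]) (some c) u := by simp [Dtop]
    rw [hDu, hD1]
    -- inner sums
    have hinner := abs_Dsum_sub_Dsum1_le hσ hZ hB hT u hregu huL [] c (by simp) hc
      (by intro h; simpa using hc1) (N := N) (by simp at hN ⊢; omega) hb
    have hinner' : |Dsum σ σ' b ([] ++ [c]) (some c) u - Dsum1 σ σ' ([] ++ [c]) (some c) u| ≤ N * Mcoef S δ 0 * (P * r) := by
      refine hinner.trans (mul_le_mul_of_nonneg_right (mul_le_mul_of_nonneg_right ?_ hM0) hPr0)
      exact_mod_cast hul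
    -- ingredients for the head term
    have hTc : σ c ≠ 0 → 1 / (σ c - 1) ≤ T := by
      intro hc0
      have hc1' : 1 < σ c := lt_of_le_of_ne ((hσ c).resolve_left hc0) (Ne.symm hc1)
      have := (topBound_ge σ (1 / 2)).2 c hc1'
      have h2 : (0 : ℝ) ≤ 2 / (1 / 2) := by norm_num
      linarith
    have hEnd : |lamEnd σ σ' c b - lamEnd1 σ σ' c| ≤ S * T ^ 2 * r :=
      abs_lamEnd_sub_lamEnd1_le hσ hZ hc1 (hB.deriv_le c hc) hTc hb'
    have hlamIn : |lamIn σ σ' c u| ≤ Mcoef S δ 0 := abs_lamIn_le hσ hB hc huL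
    have hlamEnd1 : |lamEnd1 σ σ' c| ≤ S * T := by
      unfold lamEnd1
      by_cases hc0 : σ c = 0
      · rw [if_pos hc0, abs_zero]; exact hST
      · rw [if_neg hc0, abs_div]
        have hc1' : 1 < σ c := lt_of_le_of_ne ((hσ c).resolve_left hc0) (Ne.symm hc1)
        rw [abs_of_pos (by linarith : (0 : ℝ) < σ c - 1), div_eq_mul_one_div]
        exact mul_le_mul (hB.deriv_le c hc) (hTc hc0) (by positivity) hS0
    have hlogP : ∀ {w : List α}, IsReg σ w → w.length ≤ N → hlog σ w b ≤ P := by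
      intro w hw hwl
      refine (hlog_le_log_pow hσ hw hb.1.le hb.2).trans ?_
      rw [hP]
      have hn : (w.length : ℝ) + 1 ≤ (N + 1) ^ 2 := by
        have : (w.length : ℝ) + 1 ≤ N + 1 := by exact_mod_cast Nat.succ_le_succ hwl
        nlinarith
      have h4p : (4 : ℝ) ^ w.length ≤ (4 * T) ^ N :=
        (pow_le_pow_left₀ (by norm_num) (by linarith : (4 : ℝ) ≤ 4 * T) _).trans (pow_le_pow_right₀ (by linarith) hwl)
      exact mul_le_mul (mul_le_mul hn h4p (by positivity) (by positivity)) (pow_le_pow_right₀ hΛ1 hwl)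
        (by positivity) (by positivity)
    have hhead : |(lamIn σ σ' c u - lamEnd σ σ' c b) * hlog σ u b - (lamIn σ σ' c u - lamEnd1 σ σ' c) * hlogAt1 σ u| ≤
        (S * T ^ 2 + Mcoef S δ 0 + S * T) * (P * r) := by
      by_cases hu0 : u = []
      · subst hu0
        rw [hlog_nil hσ hb', hlogAt1_nil hσ, mul_one, mul_one]
        have : (lamIn σ σ' c [] - lamEnd σ σ' c b) - (lamIn σ σ' c [] - lamEnd1 σ σ' c) =
            -(lamEnd σ σ' c b - lamEnd1 σ σ' c) := by ring
        rw [this, abs_neg]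
        calc |lamEnd σ σ' c b - lamEnd1 σ σ' c| ≤ S * T ^ 2 * r := hEnd
          _ ≤ S * T ^ 2 * (P * r) := mul_le_mul_of_nonneg_left hRr hST2
          _ ≤ (S * T ^ 2 + Mcoef S δ 0 + S * T) * (P * r) := by nlinarith
      · by_cases htopu : IsTopReg σ u
        · have hrate := abs_hlog_sub_hlogAt1_le hσ hregu htopu hT hul hb
          have hlu := hlogP hregu hul
          have heq : (lamIn σ σ' c u - lamEnd σ σ' c b) * hlog σ u b - (lamIn σ σ' c u - lamEnd1 σ σ' c) * hlogAt1 σ u =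
              -(lamEnd σ σ' c b - lamEnd1 σ σ' c) * hlog σ u b +
                (lamIn σ σ' c u - lamEnd1 σ σ' c) * (hlog σ u b - hlogAt1 σ u) := by ring
          rw [heq]
          have hco : |lamIn σ σ' c u - lamEnd1 σ σ' c| ≤ Mcoef S δ 0 + S * T :=
            (abs_sub _ _).trans (add_le_add hlamIn hlamEnd1)
          have h1 : |-(lamEnd σ σ' c b - lamEnd1 σ σ' c) * hlog σ u b| ≤ S * T ^ 2 * (P * r) := by
            rw [abs_mul, abs_neg, abs_of_nonneg (hlog_nonneg hσ hregu hb')]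
            calc |lamEnd σ σ' c b - lamEnd1 σ σ' c| * hlog σ u b ≤ (S * T ^ 2 * r) * P :=
                  mul_le_mul hEnd hlu (hlog_nonneg hσ hregu hb') (by positivity)
              _ = S * T ^ 2 * (P * r) := by ring
          have h2 : |(lamIn σ σ' c u - lamEnd1 σ σ' c) * (hlog σ u b - hlogAt1 σ u)| ≤ (Mcoef S δ 0 + S * T) * (P * r) := by
            rw [abs_mul]
            exact mul_le_mul hco hrate (abs_nonneg _) (by positivity)
          calc _ ≤ _ := abs_add_le _ _
            _ ≤ S * T ^ 2 * (P * r) + (Mcoef S δ 0 + S * T) * (P * r) := add_le_add h1 h2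
            _ = (S * T ^ 2 + Mcoef S δ 0 + S * T) * (P * r) := by ring
        · -- `u` starts with a letter at `1`: the coefficient at `b = 1` vanishes
          obtain ⟨a, u', rfl⟩ := List.exists_cons_of_ne_nil hu0
          have ha : σ a = 1 := by
            by_contra h; exact htopu (fun _ => by simpa using h)
          have hz0 := lam_sub_lamEnd1_eq_zero hZ hO hc1 ha (σ' := σ')
          simp only [lamIn]
          rw [hz0, zero_mul, sub_zero]
          have heq : lam σ σ' c a - lamEnd σ σ' c b = -(lamEnd σ σ' c b - lamEnd1 σ σ' c) := by linarith
          rw [heq, abs_mul, abs_neg, abs_of_nonneg (hlog_nonneg hσ hregu hb')]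
          calc |lamEnd σ σ' c b - lamEnd1 σ σ' c| * hlog σ (a :: u') b ≤ (S * T ^ 2 * r) * P :=
                mul_le_mul hEnd (hlogP hregu hul) (hlog_nonneg hσ hregu hb') (by positivity)
            _ = S * T ^ 2 * (P * r) := by ring
            _ ≤ (S * T ^ 2 + Mcoef S δ 0 + S * T) * (P * r) := by nlinarith
    calc |(lamIn σ σ' c u - lamEnd σ σ' c b) * hlog σ u b + Dsum σ σ' b ([] ++ [c]) (some c) u -
          ((lamIn σ σ' c u - lamEnd1 σ σ' c) * hlogAt1 σ u + Dsum1 σ σ' ([] ++ [c]) (some c) u)|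
        = |((lamIn σ σ' c u - lamEnd σ σ' c b) * hlog σ u b - (lamIn σ σ' c u - lamEnd1 σ σ' c) * hlogAt1 σ u) +
            (Dsum σ σ' b ([] ++ [c]) (some c) u - Dsum1 σ σ' ([] ++ [c]) (some c) u)| := by ring_nf
      _ ≤ _ := abs_add_le _ _
      _ ≤ (S * T ^ 2 + Mcoef S δ 0 + S * T) * (P * r) + N * Mcoef S δ 0 * (P * r) := add_le_add hhead hinner'
      _ = (N * Mcoef S δ 0 + (S * T ^ 2 + Mcoef S δ 0 + S * T)) * (P * r) := by ring

end TopDeriv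

/-! ### The values at `1` in one-parameter families -/

section FamilyTop

variable [Fintype α] [DecidableEq α] {σ σ' : ℝ → α → ℝ} {Y : Set ℝ} (hY : IsOpen Y)
  (hadm : ∀ y ∈ Y, ∀ c, σ y c = 0 ∨ 1 ≤ σ y c)
  (hZc : ∀ c, (∀ y ∈ Y, σ y c = 0) ∨ (∀ y ∈ Y, σ y c ≠ 0))
  (hZd : ∀ y ∈ Y, ∀ c, σ y c = 0 → σ' y c = 0)
  (hOc : ∀ c, (∀ y ∈ Y, σ y c = 1) ∨ (∀ y ∈ Y, σ y c ≠ 1))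
  (hOd : ∀ y ∈ Y, ∀ c, σ y c = 1 → σ' y c = 0)
  (hinj : ∀ y ∈ Y, ∀ c c', σ y c = σ y c' → c = c')
  (hder : ∀ y ∈ Y, ∀ c, HasDerivAt (fun y => σ y c) (σ' y c) y)
  (hcσ' : ∀ c, ContinuousOn (fun y => σ' y c) Y)
include hY hadm hZc hZd hOc hOd hinj hder hcσ'

omit [DecidableEq α] hZc hZd hOd hinj hcσ' in
/-- **Uniform bound of `topBound` near a point.** [folklore] -/
theorem exists_topBound_le {y₀ : ℝ} (hy₀ : y₀ ∈ Y) :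
    ∃ T : ℝ, ∃ U : Set ℝ, IsOpen U ∧ y₀ ∈ U ∧ U ⊆ Y ∧ ∀ y ∈ U, topBound (σ y) (1 / 2) ≤ T := by
  classical
  -- each summand `[1 < σ_c] / (σ_c - 1)` is eventually bounded by twice its value at `y₀` (or is `0`)
  have h : ∀ c : α, ∃ B : ℝ, ∀ᶠ y in 𝓝 y₀, (if 1 < σ y c then 1 / (σ y c - 1) else 0) ≤ B := by
    intro c
    rcases hOc c with h1 | h1
    · refine ⟨0, ?_⟩
      filter_upwards [hY.mem_nhds hy₀] with y hy
      rw [if_neg (by rw [h1 y hy]; norm_num)]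
    · by_cases hc0 : σ y₀ c = 0
      · -- zero letters stay `≤ 1`... we only know `σ y c ≠ 1`; use admissibility: `σ y c = 0 ∨ ≥ 1`
        -- near `y₀` by continuity `σ y c < 1/2`, hence `= 0`, hence the summand is `0`
        refine ⟨0, ?_⟩
        have hc : ContinuousAt (fun y => σ y c) y₀ := (hder y₀ hy₀ c).continuousAt
        have hev := hc.eventually (Iio_mem_nhds (show σ y₀ c < 1 / 2 by rw [hc0]; norm_num))
        filter_upwards [hev, hY.mem_nhds hy₀] with y hy hyY
        rw [if_neg]
        rcases hadm y hyY c with h | h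
        · rw [h]; norm_num
        · exact absurd h (by simp at hy; linarith)
      · have hc1 : 1 < σ y₀ c := lt_of_le_of_ne ((hadm y₀ hy₀ c).resolve_left hc0) (Ne.symm (h1 y₀ hy₀))
        refine ⟨2 / (σ y₀ c - 1), ?_⟩
        have hc : ContinuousAt (fun y => σ y c) y₀ := (hder y₀ hy₀ c).continuousAt
        have hev := hc.eventually (Ioi_mem_nhds (show (σ y₀ c + 1) / 2 < σ y₀ c by linarith))
        filter_upwards [hev] with y hy
        have hy' : (σ y₀ c + 1) / 2 < σ y c := hy
        have hy1 : 1 < σ y c := by linarith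
        rw [if_pos hy1]
        rw [div_le_div_iff₀ (by linarith) (by linarith)]
        linarith
  choose B hB using h
  obtain ⟨U, hUsub, hUopen, hUy₀⟩ := mem_nhds_iff.1 (((Finset.eventually_all Finset.univ).2 fun c _ => hB c).and
    (hY.mem_nhds hy₀))
  refine ⟨2 / (1 / 2) + ∑ c, B c, U, hUopen, hUy₀, fun y hy => (hUsub hy).2, fun y hy => ?_⟩
  unfold topBound
  exact add_le_add le_rfl (Finset.sum_le_sum fun c _ => (hUsub hy).1 c (Finset.mem_univ c))

omit [Fintype α] [DecidableEq α] hY hadm hZc hZd hOd hinj hder hcσ' in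
/-- Top-regularity of a word does not depend on the parameter. [folklore] -/
theorem isTopReg_family_iff {y y' : ℝ} (hy : y ∈ Y) (hy' : y' ∈ Y) (w : List α) :
    IsTopReg (σ y) w ↔ IsTopReg (σ y') w := by
  constructor <;> intro h hne
  · rcases hOc (w.head hne) with ho | ho
    · exact absurd (ho y hy) (h hne)
    · exact ho y' hy'
  · rcases hOc (w.head hne) with ho | ho
    · exact absurd (ho y' hy') (h hne)
    · exact ho y hy

/-- **Theorem T1b.** For a doubly regular word `v`, `y ↦ L_v(1; σ_y) = hlogAt1 (σ y) v` is
differentiable with derivative the deletion sum at the top `Dtop (σ y) (σ' y) v` (Goncharov's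
formula at the end-point `1`; the deletions exposing a letter at `1` drop out). The proof passes
to the limit `b → 1⁻` in Theorem T1a by locally uniform convergence of the derivatives
(`abs_Dhlog_sub_Dtop_le`). [cite: BrownENS2009, §5.1, §6.1] -/
theorem hasDerivAt_hlogAt1_family {v : List α} (hv : ∀ y ∈ Y, IsReg (σ y) v) (htop : ∀ y ∈ Y, IsTopReg (σ y) v)
    {y₀ : ℝ} (hy₀ : y₀ ∈ Y) :
    HasDerivAt (fun y => hlogAt1 (σ y) v) (Dtop (σ y₀) (σ' y₀) v) y₀ := by
  classical
  -- uniform constants on an open neighbourhood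
  obtain ⟨S, δ, U₁, hU₁o, hy₀U₁, hU₁Y, hPB⟩ := exists_pbound hY hinj hder hcσ' hy₀ v.toFinset
  obtain ⟨T, U₂, hU₂o, hy₀U₂, hU₂Y, hTB⟩ := exists_topBound_le hY hadm hOc hder hy₀
  set U := U₁ ∩ U₂ with hU
  have hUo : IsOpen U := hU₁o.inter hU₂o
  have hy₀U : y₀ ∈ U := ⟨hy₀U₁, hy₀U₂⟩
  have hUY : U ⊆ Y := fun y hy => hU₁Y hy.1
  have hL : ∀ x ∈ v, x ∈ v.toFinset := fun x hx => List.mem_toFinset.2 hx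
  set N := v.length
  -- replace `S` by `max S 0`
  set S' := max S 0 with hS'
  have hS'0 : 0 ≤ S' := le_max_right _ _
  have hPB' : ∀ y ∈ U₁, PBound (σ y) (σ' y) v.toFinset S' δ := fun y hy =>
    ⟨fun c hc => ((hPB y hy).deriv_le c hc).trans (le_max_left _ _), (hPB y hy).gap, (hPB y hy).δ_pos⟩
  set K : ℝ → ℝ := fun _ => (N * Mcoef S' δ 0 + (S' * T ^ 2 + Mcoef S' δ 0 + S' * T))
  -- the uniform rate
  have hrate : ∀ y ∈ U, ∀ b ∈ Ioo (1 / 2 : ℝ) 1, |Dhlog (σ y) (σ' y) v b - Dtop (σ y) (σ' y) v| ≤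
      K y * ((N + 1) ^ 2 * (4 * T) ^ N * (1 + |Real.log (1 - b)|) ^ N * (1 - b)) := by
    intro y hy b hb
    have hyY := hUY hy
    exact abs_Dhlog_sub_Dtop_le (hadm y hyY) (hZd y hyY) (hOd y hyY) (hPB' y hy.1) hS'0 (hTB y hy.2)
      (hv y hyY) (htop y hyY) hL le_rfl hb
  -- the rate tends to `0`
  have hK : ∀ y, K y = K y₀ := fun y => rfl
  have hr0 : Tendsto (fun b : ℝ => K y₀ * ((N + 1) ^ 2 * (4 * T) ^ N * (1 + |Real.log (1 - b)|) ^ N * (1 - b)))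
      (𝓝[<] 1) (𝓝 0) := by
    -- substitute `s = 1 - b → 0⁺` and use `(|log s|+1)^N s → 0`
    have h := tendsto_pow_log_mul_self 1 N
    have hmap : Tendsto (fun b : ℝ => 1 - b) (𝓝[<] 1) (𝓝[>] 0) := by
      refine tendsto_nhdsWithin_of_tendsto_nhds_of_eventually_within _ ?_ ?_
      · have : Tendsto (fun b : ℝ => 1 - b) (𝓝 1) (𝓝 (1 - 1)) := (continuous_const.sub continuous_id).tendsto 1
        rw [sub_self] at this
        exact this.mono_left nhdsWithin_le_nhds
      · filter_upwards [self_mem_nhdsWithin] with b hb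
        exact sub_pos.2 (show b < 1 from hb)
    have h2 := ((h.comp hmap).const_mul (K y₀ * ((N + 1) ^ 2 * (4 * T) ^ N)))
    rw [mul_zero] at h2
    refine h2.congr fun b => ?_
    simp only [Function.comp]
    ring
  -- uniform convergence of the derivatives on `U`
  have hunif : TendstoUniformlyOn (fun b y => Dhlog (σ y) (σ' y) v b) (fun y => Dtop (σ y) (σ' y) v) (𝓝[<] 1) U := by
    rw [Metric.tendstoUniformlyOn_iff]
    intro ε hε
    have hev : ∀ᶠ b in 𝓝[<] (1 : ℝ), |K y₀ * ((N + 1) ^ 2 * (4 * T) ^ N * (1 + |Real.log (1 - b)|) ^ N * (1 - b))| < ε := by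
      have := hr0.abs; rw [abs_zero] at this; exact this (Iio_mem_nhds hε)
    filter_upwards [hev, Ioo_mem_nhdsLT (by norm_num : (1 / 2 : ℝ) < 1)] with b hb hbI y hy
    rw [Real.dist_eq, abs_sub_comm]
    exact lt_of_le_of_lt ((hrate y hy b hbI).trans (le_abs_self _)) (by rwa [hK y])
  -- assemble
  refine hasDerivAt_of_tendstoUniformlyOn (f := fun b y => hlog (σ y) v b) hUo hunif ?_ ?_ hy₀U
  · filter_upwards [Ioo_mem_nhdsLT (zero_lt_one' ℝ)] with b hb y hy
    exact hasDerivAt_hlog_family hY hadm hZc hZd hinj hder hcσ' v hv (hUY hy) hb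
  · intro y hy
    exact tendsto_hlogAt1 (hadm y (hUY hy)) (hv y (hUY hy)) (htop y (hUY hy))

end FamilyTop

end Hyperlog

end Literature.NumberTheory.Transcendental
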